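import Mathlib.Topology.Algebra.Group.Quotient
import Mathlib.Tactic.Group
import Literature.AlgebraicGeometry.Frobenioids.Categories
import HarnessLib

/-!
# Slimness of extensions, of separated inverse systems and of same-kernel quotients of
# topological groups — the group-theoretic inferences of [SemiAnbd] Example 3.10 (p. 45)

Mochizuki, *Semi-graphs of anabelioids*, Publ. RIMS **42** (2006), §3 Example 3.10, manuscript
p. 45 l. 5–12 [cite: MochizukiSemiAnbd2006, Ex 3.10 p.45]: "Note that each `Δ[i]` is temp-slim.
[Indeed, this follows from the fact that `Δ_i` acts faithfully on `𝒢_i`, hence also faithfully on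
`B^temp(𝒢_i)` …; the temp-slimness portion of Proposition 3.6, (iv).] Since `Δ` is the inverse
limit of the `Δ[i]`, and `G_K` is slim …, we thus conclude that both `Δ` and `Π` are temp-slim."

PROOF-ONLY, generic topological group theory (slim = every open subgroup has trivial centraliser,
the tree's `IsSlimGroup`, [FrdI] §0 p. 13), no definitions:
* `mem_centralizer_of_normal_slim`, `isSlimGroup_of_normal_of_centralizer_le` — an extension of any
  group by a slim NORMAL subgroup `A` on which it acts outer-faithfully (`Z(A) ≤ A` in the big group)
  is slim ("each `Δ[i] = π₁^temp(𝒢_i) ⋊^out Δ_i` is temp-slim"); the key step: an element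
  centralising an open subgroup centralises every slim normal subgroup;
* `isSlimGroup_of_separating_quotients` — a group with a point-separating family of normal
  subgroups all of whose quotients are slim is slim ("`Δ` is the inverse limit of the `Δ[i]`");
* `isSlimGroup_of_slim_ker_of_slim_quotient` — slim kernel + slim image under a homomorphism
  carrying open subgroups to open subgroups ⇒ slim ("and `G_K` is slim … `Π` [is] temp-slim"; the
  profinite case is the tree's `FundamentalExtension.arith_slim_of_geom_slim_of_gal_slim`,
  [AbsAnab] Lemma 1.3.1);
* `isSlimGroup_of_same_ker` — slimness passes between two homomorphic images of one group with the
  same kernel (open map on one side, continuous surjection on the other).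
Consumed by `TemperedSpecialFibreTower.lean` (the sub-DAG statements file of Example 3.10,
plan/L3/SUBDAG-SemiAnbd-Ex310.md). Nothing disputed is touched.
-/

open Topology

namespace Literature.AnabelianGeometry.SemiGraphs

open Literature.AlgebraicGeometry.Frobenioids (IsSlimGroup)

universe u

/-! ### The three group-theoretic inferences of p. 45, PROVED for abstract topological groups -/

section Engine

variable {E : Type u} [Group E] [TopologicalSpace E] [IsTopologicalGroup E]

/-- A slim topological group admits no non-trivial "partial centraliser twist": if `A ⊴ E`, the
subgroup `A` is slim (subspace topology) and `z ∈ E` centralises an open subgroup `U` of `E`, then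
`z` centralises all of `A`.  (For `a ∈ A` the commutator `a⁻¹ z a z⁻¹ ∈ A` centralises the open
subgroup `{w ∈ A | w ∈ U, a w a⁻¹ ∈ U}` of `A`, hence is trivial.)  This is the step "`Δ_i` acts
faithfully … on `B^temp(𝒢_i)` … temp-slimness … of Proposition 3.6, (iv)" ⇒ "`Δ[i]` is temp-slim"
of [SemiAnbd] Example 3.10 (p. 45), first half. [cite: MochizukiSemiAnbd2006, Ex 3.10 p.45] -/
theorem mem_centralizer_of_normal_slim (A : Subgroup E) [A.Normal] (hA : IsSlimGroup A)
    {U : Subgroup E} (hU : IsOpen (U : Set E)) {z : E}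
    (hz : z ∈ Subgroup.centralizer (U : Set E)) :
    z ∈ Subgroup.centralizer (A : Set E) := by
  rw [Subgroup.mem_centralizer_iff] at hz ⊢
  intro a ha
  -- the open subgroup `W = {w ∈ A | w ∈ U ∧ a w a⁻¹ ∈ U}` of `A`
  let V : Subgroup E := U ⊓ U.comap (MulAut.conj a).toMonoidHom
  have hVopen : IsOpen (V : Set E) := by
    change IsOpen ((U : Set E) ∩ (MulAut.conj a).toMonoidHom ⁻¹' (U : Set E))
    refine hU.inter (hU.preimage ?_)
    change Continuous fun x : E => a * x * a⁻¹
    fun_prop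
  let W : Subgroup A := V.comap A.subtype
  have hWopen : IsOpen (W : Set A) := by
    change IsOpen (A.subtype ⁻¹' (V : Set E))
    exact hVopen.preimage continuous_subtype_val
  -- the commutator `c := a⁻¹ (z a z⁻¹)` lies in `A` and centralises `W`
  have hc_mem : a⁻¹ * (z * a * z⁻¹) ∈ A :=
    A.mul_mem (A.inv_mem ha) (‹A.Normal›.conj_mem a ha z)
  have hc_centr : (⟨a⁻¹ * (z * a * z⁻¹), hc_mem⟩ : A) ∈ Subgroup.centralizer (W : Set A) := by
    rw [Subgroup.mem_centralizer_iff]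
    rintro ⟨w, hwA⟩ hw
    have hwV : w ∈ V := hw
    have hwU : w ∈ U := hwV.1
    have hawU : a * w * a⁻¹ ∈ U := by
      have := hwV.2
      simpa [Subgroup.mem_comap] using this
    -- `z` commutes with `w` and with `a w a⁻¹`
    have h1 : w * z = z * w := hz w hwU
    have h2 : a * w * a⁻¹ * z = z * (a * w * a⁻¹) := hz _ hawU
    apply Subtype.ext
    change w * (a⁻¹ * (z * a * z⁻¹)) = a⁻¹ * (z * a * z⁻¹) * w
    -- from `h2`: `z a w = a w a⁻¹ z a`, and `z w = w z`
    have hzw : z⁻¹ * w = w * z⁻¹ := by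
      rw [inv_mul_eq_iff_eq_mul, ← mul_assoc, eq_mul_inv_iff_mul_eq, h1]
    have h3 : z * a * z⁻¹ * w = a * w * a⁻¹ * (z * a * z⁻¹) := by
      calc z * a * z⁻¹ * w = z * a * (z⁻¹ * w) := by group
        _ = z * a * (w * z⁻¹) := by rw [hzw]
        _ = z * (a * w * a⁻¹) * a * z⁻¹ := by group
        _ = a * w * a⁻¹ * z * a * z⁻¹ := by rw [← h2]
        _ = a * w * a⁻¹ * (z * a * z⁻¹) := by group
    calc w * (a⁻¹ * (z * a * z⁻¹)) = a⁻¹ * (a * w * a⁻¹ * (z * a * z⁻¹)) := by group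
      _ = a⁻¹ * (z * a * z⁻¹ * w) := by rw [h3]
      _ = a⁻¹ * (z * a * z⁻¹) * w := by group
  have htriv := hA.centralizer_eq_bot W hWopen
  rw [htriv, Subgroup.mem_bot] at hc_centr
  have : a⁻¹ * (z * a * z⁻¹) = 1 := congrArg Subtype.val hc_centr
  -- hence `z a z⁻¹ = a`
  have h4 : z * a * z⁻¹ = a := by
    have := congrArg (a * ·) this
    simpa [← mul_assoc] using this
  calc a * z = z * a * z⁻¹ * z := by rw [h4]
    _ = z * a := by group

/-- **"`Δ[i]` is temp-slim"** ([SemiAnbd] Ex. 3.10 p. 45 l. 5–7), as abstract group theory: if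
`A ⊴ E` is a slim subgroup such that every element of `E` centralising `A` lies in `A` (the outer
action of `E/A` on `A` is faithful — "`Δ_i` acts faithfully … on `B^temp(𝒢_i)`"), then `E` is slim.
[cite: MochizukiSemiAnbd2006, Ex 3.10 p.45] -/
theorem isSlimGroup_of_normal_of_centralizer_le (A : Subgroup E) [A.Normal] (hA : IsSlimGroup A)
    (hfaith : Subgroup.centralizer (A : Set E) ≤ A) : IsSlimGroup E := by
  refine ⟨fun U hU => ?_⟩
  rw [eq_bot_iff]
  intro z hz
  have hzA : z ∈ A := hfaith (mem_centralizer_of_normal_slim A hA hU hz)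
  -- `z ∈ A` centralises the open subgroup `U ∩ A` of `A`
  have hV : IsOpen ((U.comap A.subtype : Subgroup A) : Set A) := by
    change IsOpen (A.subtype ⁻¹' (U : Set E))
    exact hU.preimage continuous_subtype_val
  have htriv := hA.centralizer_eq_bot (U.comap A.subtype) hV
  have : (⟨z, hzA⟩ : A) ∈ Subgroup.centralizer ((U.comap A.subtype : Subgroup A) : Set A) := by
    rw [Subgroup.mem_centralizer_iff]
    rintro ⟨u, huA⟩ hu
    exact Subtype.ext ((Subgroup.mem_centralizer_iff.mp hz) u hu)
  rw [htriv, Subgroup.mem_bot] at this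
  exact Subgroup.mem_bot.mpr (congrArg Subtype.val this)

/-- **"Since `Δ` is the inverse limit of the `Δ[i]` … we thus conclude that `Δ` [is] temp-slim"**
([SemiAnbd] Ex. 3.10 p. 45 l. 10–12), as abstract group theory: if a family of normal subgroups
`K i ⊴ E` separates points (`⋂ K_i = 1`, i.e. `E ↪ ∏ E/K_i`) and every quotient `E / K_i` is slim for
the quotient topology, then `E` is slim. [cite: MochizukiSemiAnbd2006, Ex 3.10 p.45] -/
theorem isSlimGroup_of_separating_quotients {ι : Sort*} (K : ι → Subgroup E) [∀ i, (K i).Normal]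
    (hsep : ∀ z : E, (∀ i, z ∈ K i) → z = 1) (hslim : ∀ i, IsSlimGroup (E ⧸ K i)) :
    IsSlimGroup E := by
  refine ⟨fun U hU => ?_⟩
  rw [eq_bot_iff]
  intro z hz
  refine Subgroup.mem_bot.mpr (hsep z fun i => ?_)
  have hopen : IsOpen ((U.map (QuotientGroup.mk' (K i)) : Subgroup (E ⧸ K i)) : Set (E ⧸ K i)) := by
    rw [Subgroup.coe_map]
    exact QuotientGroup.isOpenMap_coe _ hU
  have hc : (QuotientGroup.mk' (K i) z) ∈
      Subgroup.centralizer ((U.map (QuotientGroup.mk' (K i)) : Subgroup (E ⧸ K i)) : Set (E ⧸ K i)) := by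
    rw [Subgroup.mem_centralizer_iff]
    rintro _ ⟨u, hu, rfl⟩
    rw [← map_mul, ← map_mul, (Subgroup.mem_centralizer_iff.mp hz) u hu]
  rw [(hslim i).centralizer_eq_bot _ hopen, Subgroup.mem_bot] at hc
  exact (QuotientGroup.eq_one_iff z).mp hc

omit [IsTopologicalGroup E] in
/-- **"and `G_K` is slim … we thus conclude that … `Π` [is] temp-slim"** ([SemiAnbd] Ex. 3.10
p. 45 l. 10–12; the deduction is the "formal consequence" of [AbsAnab] Lemma 1.3.1 written for an
arbitrary topological group instead of a profinite one): if `f : E → G` is a homomorphism carrying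
open subgroups to open subgroups (e.g. an open continuous surjection), with slim kernel and slim
target, then `E` is slim. [cite: MochizukiSemiAnbd2006, Ex 3.10 p.45] -/
theorem isSlimGroup_of_slim_ker_of_slim_quotient {G : Type*} [Group G] [TopologicalSpace G]
    (f : E →* G) (hopen : ∀ U : Subgroup E, IsOpen (U : Set E) → IsOpen ((U.map f : Subgroup G) : Set G))
    (hker : IsSlimGroup f.ker) (hG : IsSlimGroup G) : IsSlimGroup E := by
  refine ⟨fun U hU => ?_⟩
  rw [eq_bot_iff]
  intro z hz
  have hzU := Subgroup.mem_centralizer_iff.mp hz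
  have h1 : f z = 1 := by
    have hc : f z ∈ Subgroup.centralizer ((U.map f : Subgroup G) : Set G) := by
      rw [Subgroup.mem_centralizer_iff]
      rintro _ ⟨u, hu, rfl⟩
      rw [← map_mul, ← map_mul, hzU u hu]
    rw [hG.centralizer_eq_bot _ (hopen U hU), Subgroup.mem_bot] at hc
    exact hc
  have hzK : z ∈ f.ker := h1
  have hV : IsOpen ((U.comap f.ker.subtype : Subgroup f.ker) : Set f.ker) := by
    change IsOpen (f.ker.subtype ⁻¹' (U : Set E))
    exact hU.preimage continuous_subtype_val
  have hc := hker.centralizer_eq_bot (U.comap f.ker.subtype) hV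
  have : (⟨z, hzK⟩ : f.ker) ∈ Subgroup.centralizer ((U.comap f.ker.subtype : Subgroup f.ker) : Set f.ker) := by
    rw [Subgroup.mem_centralizer_iff]
    rintro ⟨u, huK⟩ hu
    exact Subtype.ext (hzU u hu)
  rw [hc, Subgroup.mem_bot] at this
  exact Subgroup.mem_bot.mpr (congrArg Subtype.val this)

end Engine

/-! ### A transfer lemma: two quotients of one group by the same kernel are slim together -/

section Transfer

variable {H : Type*} [Group H] [TopologicalSpace H]
  {L₁ : Type*} [Group L₁] [TopologicalSpace L₁] {L₂ : Type*} [Group L₂] [TopologicalSpace L₂]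

/-- Slimness passes between two homomorphic images of one topological group with the SAME kernel,
from an image reached by an OPEN homomorphism to an image reached by a CONTINUOUS surjection (used
to move the temp-slimness of the chart `π₁^temp(𝒢_i)` — the target of the admissible quotient
`N_i ↠ π₁^temp(𝒢_i)` — to the image `N_i / admKer i` of `N_i` inside `Δ[i] = Δ / admKer i`).
[cite: MochizukiSemiAnbd2006, Ex 3.10 p.45] -/
theorem isSlimGroup_of_same_ker (f₁ : H →* L₁) (hf₁ : IsOpenMap f₁) (hL₁ : IsSlimGroup L₁)
    (f₂ : H →* L₂) (hf₂ : Continuous f₂) (hf₂s : Function.Surjective f₂)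
    (hker : f₁.ker = f₂.ker) : IsSlimGroup L₂ := by
  refine ⟨fun U hU => ?_⟩
  rw [eq_bot_iff]
  intro z₂ hz₂
  obtain ⟨z, rfl⟩ := hf₂s z₂
  have hzU := Subgroup.mem_centralizer_iff.mp hz₂
  -- `V := f₂⁻¹(U)` is an open subgroup of `H`; `f₁ z` centralises the open subgroup `f₁(V)` of `L₁`
  have hV : IsOpen ((U.comap f₂ : Subgroup H) : Set H) := hU.preimage hf₂
  have hopen : IsOpen (((U.comap f₂).map f₁ : Subgroup L₁) : Set L₁) := by
    rw [Subgroup.coe_map]; exact hf₁ _ hV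
  have hc : f₁ z ∈ Subgroup.centralizer (((U.comap f₂).map f₁ : Subgroup L₁) : Set L₁) := by
    rw [Subgroup.mem_centralizer_iff]
    rintro _ ⟨v, hv, rfl⟩
    -- `[z, v] ∈ ker f₂ = ker f₁`
    have h1 : f₂ v * f₂ z = f₂ z * f₂ v := hzU (f₂ v) hv
    have h2 : v * z * (z * v)⁻¹ ∈ f₂.ker := by
      rw [MonoidHom.mem_ker, map_mul, map_mul, map_inv, map_mul, h1, mul_inv_cancel]
    rw [← hker, MonoidHom.mem_ker, map_mul, map_inv, map_mul, map_mul, mul_inv_eq_one] at h2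
    exact h2
  rw [hL₁.centralizer_eq_bot _ hopen, Subgroup.mem_bot] at hc
  have hz : z ∈ f₂.ker := by rw [← hker]; exact hc
  exact Subgroup.mem_bot.mpr hz

end Transfer

end Literature.AnabelianGeometry.SemiGraphs
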